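import Literature.MathematicalPhysics.QuantumLattice.HubbardThermalFermionDecayProofs
import Literature.MathematicalPhysics.QuantumLattice.HubbardWave0LiebProofs
import Literature.MathematicalPhysics.QuantumLattice.HubbardOneParticleCost

/-!
# Sector bookkeeping and the fermionic light cone for `ParityGapClustering`

Support file for item `stmt-HubbardSuperconductivity-2197` (`ParityGapClustering`) of route
`HubbardSuperconductivity/ParityGapRigidity`. Two model-specific inputs of the sector-relative
Hastings–Koma argument:

* `dotProduct_eq_zero_of_eigenvalue_lt_groundEnergy` — for a particle-number conserving matrix `M`
  on Fock space (entrywise: `M s s' ≠ 0 ⟹ |s| = |s'|`), an eigenvector `v` of `M` with eigenvalue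
  `λ < E_M(n)` (the variational sector energy `groundEnergy M n`) is orthogonal to every `n`-particle
  vector (the sector truncation of `v` is again an eigenvector with eigenvalue `λ`, hence vanishes by
  the variational principle). This is what makes the ONE-SIDED gaps on the `(N ± 1)`-particle
  spaces the only spectral input: no eigenbasis adapted to the sectors is needed.
* `norm_anticomm_creation_heisenbergEvolution_annihilation_le` — the anticommutator Lieb–Robinson
  bound of the tree (`norm_anticommutator_hubbardTorus_le`, Hastings–Koma App. A / Hastings 2004) for
  `{c†_{xσ}, τ_t(c_{yτ})}` on the Hubbard torus `hubbardTorus 2 L 1 U` (chemical potential `0`, so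
  the velocity is uniform in `L` and in the sector), for times of BOTH signs, in the closed form
  `C e^{-(d - v|t|)}` consumed by the filter lemma.

Theorems only; no definitions.

References: M. B. Hastings, T. Koma, CMP 265 (2006) 781, §3 and App. A; H. Tasaki, *Physics and
Mathematics of Quantum Many-Body Systems* (2020) §2.1 (variational principle).
-/

noncomputable section

-- the mandated namespace `Summit.<Summit>.<Problem>.Theorems` repeats `HubbardSuperconductivity`
-- (single-problem summit, D-0017), which the `dupNamespace` linter flags on every declaration
set_option linter.dupNamespace false

open Matrix Complex Finset Real
open scoped Matrix.Norms.L2Operator ComplexOrder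

namespace Summit.HubbardSuperconductivity.HubbardSuperconductivity.Theorems

open Literature.MathematicalPhysics.QuantumLattice Literature.Probability.LatticeModels

section Sector

variable {ι : Type*} [Fintype ι]

/-- **Eigenvectors below a sector's variational energy are orthogonal to that sector.** Let `M` be
a matrix on the fermionic Fock space conserving the particle number entrywise
(`M s s' ≠ 0 ⟹ |s| = |s'|`), `M v = λ v`, and `λ < groundEnergy M n` (the infimum of `Re⟨φ, Mφ⟩`
over unit `n`-particle vectors). Then `⟨v, w⟩ = 0` for every `n`-particle vector `w`: the
truncation `φ` of `v` to the `n`-particle configurations satisfies `Mφ = λφ`, so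
`E(n)‖φ‖² ≤ Re⟨φ, Mφ⟩ = λ‖φ‖²` forces `φ = 0`. Tasaki (2020) §2.1 (variational principle).
[folklore] -/
theorem dotProduct_eq_zero_of_eigenvalue_lt_groundEnergy (M : Matrix (Finset ι) (Finset ι) ℂ)
    (hM : ∀ s s' : Finset ι, M s s' ≠ 0 → s.card = s'.card) {n : ℕ} {v w : Fock ι} {lam : ℝ}
    (hv : M *ᵥ v = (lam : ℂ) • v) (hlam : lam < groundEnergy M n) (hw : IsNParticle n w) :
    star v ⬝ᵥ w = 0 := by
  classical
  -- the sector truncation of `v`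
  obtain ⟨φ, hφ⟩ : ∃ φ : Fock ι, ∀ s, φ s = if s.card = n then v s else 0 := ⟨_, fun _ => rfl⟩
  have hφn : IsNParticle n φ := fun s hs => by rw [hφ, if_neg hs]
  have hzero : ∀ s s' : Finset ι, s.card ≠ s'.card → M s s' = 0 := fun s s' h => by
    by_contra h'
    exact h (hM s s' h')
  have hMφ : M *ᵥ φ = (lam : ℂ) • φ := by
    funext s
    have hvs : (M *ᵥ v) s = (lam : ℂ) * v s := by rw [hv]; rfl
    simp only [mulVec, dotProduct] at hvs
    simp only [mulVec, dotProduct, Pi.smul_apply, smul_eq_mul, hφ]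
    by_cases hs : s.card = n
    · rw [if_pos hs, ← hvs]
      refine Finset.sum_congr rfl fun s' _ => ?_
      by_cases hs' : s'.card = n
      · rw [if_pos hs']
      · rw [if_neg hs', hzero s s' (by rw [hs]; exact Ne.symm hs'), zero_mul, zero_mul]
    · rw [if_neg hs, mul_zero]
      refine Finset.sum_eq_zero fun s' _ => ?_
      by_cases hs' : s'.card = n
      · rw [hzero s s' (by rw [hs']; exact hs), zero_mul]
      · rw [if_neg hs', mul_zero]
  -- the variational principle forces `φ = 0`
  have hE := LiebThm1.groundEnergy_mul_norm_le M hφn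
  have hexp : (expect M φ).re = lam * (star φ ⬝ᵥ φ).re := by
    rw [Literature.MathematicalPhysics.QuantumLattice.expect, hMφ, dotProduct_smul, smul_eq_mul,
      Complex.re_ofReal_mul]
  rw [hexp] at hE
  have hre : star φ ⬝ᵥ φ = (((star φ ⬝ᵥ φ).re : ℝ) : ℂ) :=
    ThermodynamicLimit.star_dotProduct_self_eq_re φ
  have hnn : 0 ≤ (star φ ⬝ᵥ φ).re := by
    rw [dotProduct, Complex.re_sum]
    refine Finset.sum_nonneg fun s _ => ?_
    rw [Pi.star_apply, Complex.star_def, Complex.conj_mul', ← Complex.ofReal_pow,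
      Complex.ofReal_re]
    positivity
  have hr0 : (star φ ⬝ᵥ φ).re = 0 := by
    nlinarith
  have hφ0 : φ = 0 := by
    rw [← dotProduct_star_self_eq_zero, hre, hr0, Complex.ofReal_zero]
  -- `⟨v, w⟩ = ⟨φ, w⟩ = 0`
  have hvw : star v ⬝ᵥ w = star φ ⬝ᵥ w := by
    simp only [dotProduct, Pi.star_apply]
    refine Finset.sum_congr rfl fun s _ => ?_
    by_cases hs : s.card = n
    · rw [hφ, if_pos hs]
    · rw [hw s hs, mul_zero, mul_zero]
  rw [hvw, hφ0, star_zero, zero_dotProduct]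

/-- The Hubbard Hamiltonian conserves the particle number entrywise: a nonzero matrix element
`H s s'` joins configurations with the same number of electrons (it even conserves `N↑`, `N↓`,
`LiebThm1.preservesSectors_hamiltonian`). Lieb, PRL 62 (1989) 1201, Remark (2). [folklore] -/
theorem card_eq_card_of_hamiltonian_ne_zero {Λ : Type*} [LinearOrder Λ] [Fintype Λ]
    (G : SimpleGraph Λ) [DecidableRel G.Adj] (t U : ℝ) (s s' : Finset (Orb Λ))
    (h : hamiltonian G t U s s' ≠ 0) : s.card = s'.card := by
  have hp := LiebThm1.preservesSectors_hamiltonian G t U s s' h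
  rw [card_eq_upPart_add_downPart, card_eq_upPart_add_downPart s', hp.1, hp.2]

end Sector

section LightCone

/-- `{c†_i, c_j} = 0` for distinct orbitals (CAR). Bratteli–Robinson II §5.2.2. [folklore] -/
theorem creation_mul_annihilation_add {ι : Type*} [LinearOrder ι] [Fintype ι] {i j : ι}
    (hij : i ≠ j) :
    (creation i * annihilation j + annihilation j * creation i :
      Matrix (Finset ι) (Finset ι) ℂ) = 0 := by
  have h := annihilation_mul_creation_add_creation_mul_annihilation_holds (ι := ι) j i
  rw [if_neg (Ne.symm hij)] at h
  rw [add_comm]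
  exact h

/-- **The fermionic light cone for `{c†_{xσ}, τ_t(c_{yτ})}` on the Hubbard torus, both time
directions, closed form.** For distinct orbitals `(x,σ) ≠ (y,τ)` of `(ℤ/Lℤ)²` and every real `t`,
`‖c†_{xσ} τ_t(c_{yτ}) + τ_t(c_{yτ}) c†_{xσ}‖ ≤ C_U e^{-(dist(x,y) - v_U |t|)}` with
`C_U = 36(2+|U|)e`, `v_U = 36e(2+|U|) + 1`, uniformly in `L` (the tree's
`norm_anticommutator_hubbardTorus_le` at chemical potential `0`, for `t ≥ 0` with the roles of the
two odd observables exchanged and for `t ≤ 0` after time reversal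
`norm_anticommutator_heisenbergEvolution_neg`; `s e^{κs} ≤ e^{(κ+1)s}`).
Hastings–Koma, CMP 265 (2006) App. A; Hastings, PRL 93 (2004) 126402. [folklore] -/
theorem norm_anticomm_creation_heisenbergEvolution_annihilation_le (U : ℝ) {L : ℕ} [NeZero L]
    [instDE : DecidableEq (FermionTorus 2 L)] (x y : FermionTorus 2 L) (σ τ : Fin 2)
    (hne : orb x σ ≠ orb y τ) (t : ℝ) :
    ‖creation (orb x σ) * heisenbergEvolution (hubbardTorus 2 L 1 U) t (annihilation (orb y τ)) +
        heisenbergEvolution (hubbardTorus 2 L 1 U) t (annihilation (orb y τ)) * creation (orb x σ)‖ ≤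
      36 * (2 + |U|) * Real.exp 1 *
        Real.exp (-1 * ((torusDist x.toTorusSite y.toTorusSite : ℝ) -
          (Real.exp 1 * (2 * (2 + |U|) * 18) + 1) * |t|)) := by
  -- instance bookkeeping: elaborate everything through `LinearOrder.toDecidableEq`, the instance
  -- carried by the generic lemmas (cf. `norm_anticommutator_hubbardTorus_le`)
  obtain rfl : instDE = LinearOrder.toDecidableEq := Subsingleton.elim _ _
  letI instDE : DecidableEq (FermionTorus 2 L) := LinearOrder.toDecidableEq
  set A : Matrix (Finset (Orb (FermionTorus 2 L))) (Finset (Orb (FermionTorus 2 L))) ℂ :=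
    creation (orb x σ) with hA_def
  set B : Matrix (Finset (Orb (FermionTorus 2 L))) (Finset (Orb (FermionTorus 2 L))) ℂ :=
    annihilation (orb y τ) with hB_def
  have hH : (hubbardTorus 2 L 1 U).IsHermitian := LiebThm1.hamiltonian_isHermitian _ 1 U
  have hA1 : ‖A‖ ≤ 1 := norm_creation_le_one _
  have hB1 : ‖B‖ ≤ 1 := norm_annihilation_le_one _
  have hAmem : A ∈ carSubalgebra (orbSet ({FermionTorus.ofTorusSite x.toTorusSite} :
      Finset (FermionTorus 2 L))) := by
    rw [FermionTorus.ofTorusSite_toTorusSite]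
    exact creation_mem_carSubalgebra (orb_mem_orbSet (Finset.mem_singleton_self x) σ)
  have hBmem : B ∈ carSubalgebra (orbSet ({FermionTorus.ofTorusSite y.toTorusSite} :
      Finset (FermionTorus 2 L))) := by
    rw [FermionTorus.ofTorusSite_toTorusSite]
    exact annihilation_mem_carSubalgebra (orb_mem_orbSet (Finset.mem_singleton_self y) τ)
  have hAodd : parityOp * A = -(A * parityOp) := parityOp_mul_creation _
  have hBodd : parityOp * B = -(B * parityOp) := parityOp_mul_annihilation_holds _
  have hAB : A * B + B * A = 0 := creation_mul_annihilation_add hne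
  have hBA : B * A + A * B = 0 := by rw [add_comm]; exact hAB
  have hJ : 2 * |(1 : ℝ)| + |U| + 2 * |(0 : ℝ)| = 2 + |U| := by
    rw [abs_one, abs_zero]; ring
  have h18 : ((2 * (2 * 4 + 1) : ℕ) : ℝ) = 18 := by norm_num
  set κ : ℝ := Real.exp 1 * (2 * (2 + |U|) * 18) with hκ
  have hκ0 : 0 ≤ κ := by positivity
  -- the one-sided bound for `s ≥ 0`, in both orderings
  have key : ∀ s : ℝ, 0 ≤ s → ∀ d : ℕ,
      36 * (2 * |(1 : ℝ)| + |U| + 2 * |(0 : ℝ)|) * Real.exp 1 * s *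
        Real.exp (Real.exp 1 * (2 * (2 * |(1 : ℝ)| + |U| + 2 * |(0 : ℝ)|) *
          ((2 * (2 * 4 + 1) : ℕ) : ℝ)) * s - (d : ℝ)) ≤
      36 * (2 + |U|) * Real.exp 1 * Real.exp (-1 * ((d : ℝ) - (κ + 1) * s)) := by
    intro s hs d
    rw [hJ, h18, ← hκ]
    have h1 : s ≤ Real.exp s := by linarith [Real.add_one_le_exp s]
    calc 36 * (2 + |U|) * Real.exp 1 * s * Real.exp (κ * s - d)
        ≤ 36 * (2 + |U|) * Real.exp 1 * Real.exp s * Real.exp (κ * s - d) := by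
          gcongr
      _ = 36 * (2 + |U|) * Real.exp 1 * Real.exp (-1 * ((d : ℝ) - (κ + 1) * s)) := by
          rw [mul_assoc (36 * (2 + |U|) * Real.exp 1), ← Real.exp_add]
          congr 2
          ring
  rcases le_or_gt 0 t with ht | ht
  · -- `t ≥ 0`: `‖{A, τ_t(B)}‖ = ‖{τ_t(B), A}‖`, the tree's bound with the roles exchanged
    have hLR := norm_anticommutator_hubbardTorus_le U 0 y.toTorusSite x.toTorusSite hBmem hAmem
      hBodd hB1 hA1 ht
    rw [hubbardTorusWith_zero, hBA, norm_zero, zero_add, torusDist_comm'] at hLR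
    rw [add_comm, abs_of_nonneg ht]
    exact hLR.trans (key t ht _)
  · -- `t < 0`: time reversal
    obtain ⟨s, rfl⟩ : ∃ s, t = -s := ⟨-t, by ring⟩
    have hs : 0 ≤ s := by linarith
    have hLR := norm_anticommutator_hubbardTorus_le U 0 x.toTorusSite y.toTorusSite hAmem hBmem
      hAodd hA1 hB1 hs
    rw [hubbardTorusWith_zero, hAB, norm_zero, zero_add] at hLR
    rw [add_comm, norm_anticommutator_heisenbergEvolution_neg hH s B A, abs_neg, abs_of_nonneg hs]
    exact hLR.trans (key s hs _)

end LightCone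

end Summit.HubbardSuperconductivity.HubbardSuperconductivity.Theorems

end
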